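import Literature.AlgebraicGeometry.PlaneCurves.HessePencilCharacteristicThree
import HarnessLib

/-!
# Remark 2.1's coordinate change: the web cubic `xy(ax + by + cz) + dz³` to the Hesse form in characteristic `3` (Artebani–Dolgachev)

Topic `Literature/AlgebraicGeometry/PlaneCurves`, namespace `Literature.AlgebraicGeometry.PlaneCurves`.
Lane `lit-hodgefound`, seat `lit-hodgefound-p37`, row g21-#9; sequel of
`HessePencilCharacteristicThree` (g21-#1: `E_t = (X + Y + Z)³ + tXYZ` for `3 = 0`).  Everything
here is PROVED; no definition, no named fact.

Source — M. Artebani, I. Dolgachev, *The Hesse pencil of plane cubic curves*, Enseign. Math. (2) 55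
(2009), §2, proof of Lemma 1, eq. (4) [`paper:arxiv-math_0611590` p0004 L55]: "the equation of `E`
can be written in the form `F(x, y, z) = xy(ax + by + cz) + dz³ = 0`, where `ax + by + cz = 0` is a
third inflection tangent line", and Remark 2.1 [p0005 L60–61], VERBATIM: "We find equation (4) and
check that it defines a nonsingular curve only if `abc ≠ 0`.  By scaling the variables we may assume
that `a = b = −1, c = 1`.  Next we use the variable change `z = u + x + y` to transform the equation to
the Hesse form `xyu + d(u + x + y)³ = xyu + d(u³ + x³ + y³) = 0`."

## What is here (for `abc ≠ 0`; the two steps composed into ONE substitution)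

With `S = [[−a⁻¹, 0, 0], [0, −b⁻¹, 0], [c⁻¹, c⁻¹, c⁻¹]]` (`x ↦ −x/a`, `y ↦ −y/b`,
`z ↦ (x + y + z)/c`: the scaling followed by `z = u + x + y`):
* `web_bind₁_scale_translate` (any field): `F ∘ S = (ab)⁻¹·XYZ + (d/c³)·(X + Y + Z)³`
  ("`xyu + d(u + x + y)³`", up to the scalings);
* **`web_bind₁_of_three_eq_zero`** (`3 = 0`): `F ∘ S = (ab)⁻¹·XYZ + (d/c³)·(X³ + Y³ + Z³)`
  ("`= xyu + d(u³ + x³ + y³)`");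
* **`web_bind₁_eq_smul_hesseE`** (`3 = 0`, `d ≠ 0`): `F ∘ S = (d/c³) · E_t` with `t = c³/(abd)` — the
  web cubic IS a nonsingular member of the Hesse pencil up to projective equivalence (`t ≠ 0`);
* `web_matrix_det` (`det S = (abc)⁻¹ ≠ 0`); `web_reducible_of_d_eq_zero` (`d = 0`: `F = xy·ℓ`).

## References
* [ArtebaniDolgachev2009] M. Artebani, I. Dolgachev, *The Hesse pencil of plane cubic curves*,
  Enseign. Math. (2) 55 (2009) 235–273, §2, Lemma 1 eq. (4) and Remark 2.1.
-/

set_option autoImplicit false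

open MvPolynomial Matrix

namespace Literature.AlgebraicGeometry.PlaneCurves

universe u

/-- The member `E_t = X³ + Y³ + Z³ + t·XYZ` (local notation, no definition). -/
local notation3 "𝐄[" t "]" =>
  (X 0 ^ 3 + X 1 ^ 3 + X 2 ^ 3 + C t * (X 0 * X 1 * X 2) : MvPolynomial (Fin 3) _)

/-- The web cubic `F = xy(ax + by + cz) + dz³` of Lemma 1, eq. (4) (local notation, no definition). -/
local notation3 "𝐅[" a ", " b ", " c ", " d "]" =>
  (X 0 * X 1 * (C a * X 0 + C b * X 1 + C c * X 2) + C d * X 2 ^ 3 : MvPolynomial (Fin 3) _)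

/-- `S = [[−a⁻¹, 0, 0], [0, −b⁻¹, 0], [c⁻¹, c⁻¹, c⁻¹]]`: the scaling `a = b = −1, c = 1` followed by
`z = u + x + y` (local notation, no definition). -/
local notation3 "𝐒[" a ", " b ", " c "]" =>
  (Matrix.of ![![-a⁻¹, 0, 0], ![0, -b⁻¹, 0], ![c⁻¹, c⁻¹, c⁻¹]] : Matrix (Fin 3) (Fin 3) _)

section CharThreeWebForm

variable {K : Type u} [Field K]

/-- Row `i` of `M.toMvPolynomial` on `Fin 3`, written out. [folklore] -/
private theorem toMvPolynomial_fin_three_w (M : Matrix (Fin 3) (Fin 3) K) (i : Fin 3) :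
    M.toMvPolynomial i = C (M i 0) * X 0 + C (M i 1) * X 1 + C (M i 2) * X 2 := by
  simp only [Matrix.toMvPolynomial, Fin.sum_univ_three, ← C_mul_X_eq_monomial]

/-- **"By scaling the variables we may assume that `a = b = −1, c = 1`.  Next we use the variable change
`z = u + x + y`"** — both steps as one substitution `S`, over any field (`abc ≠ 0`):
`F ∘ S = (ab)⁻¹·XYZ + (d/c³)·(X + Y + Z)³`. [cite: ArtebaniDolgachev2009, §2, Remark 2.1] -/
theorem web_bind₁_scale_translate {a b c : K} (ha : a ≠ 0) (hb : b ≠ 0) (hc : c ≠ 0) (d : K) :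
    bind₁ (𝐒[a, b, c] : Matrix (Fin 3) (Fin 3) K).toMvPolynomial 𝐅[a, b, c, d] =
      C (a⁻¹ * b⁻¹) * (X 0 * X 1 * X 2) + C (d * c⁻¹ ^ 3) * (X 0 + X 1 + X 2) ^ 3 := by
  have hA : (C a : MvPolynomial (Fin 3) K) * C a⁻¹ = 1 := by rw [← map_mul, mul_inv_cancel₀ ha, map_one]
  have hB : (C b : MvPolynomial (Fin 3) K) * C b⁻¹ = 1 := by rw [← map_mul, mul_inv_cancel₀ hb, map_one]
  have hC : (C c : MvPolynomial (Fin 3) K) * C c⁻¹ = 1 := by rw [← map_mul, mul_inv_cancel₀ hc, map_one]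
  simp only [map_add, map_mul, map_pow, bind₁_X_right, bind₁_C_right, toMvPolynomial_fin_three_w]
  simp [map_neg]
  linear_combination (-(C a⁻¹ * C b⁻¹ * X 0 ^ 2 * X 1)) * hA +
    (-(C a⁻¹ * C b⁻¹ * X 0 * X 1 ^ 2)) * hB +
    (C a⁻¹ * C b⁻¹ * X 0 * X 1 * (X 0 + X 1 + X 2)) * hC

/-- **"… to transform the equation to the Hesse form `xyu + d(u + x + y)³ = xyu + d(u³ + x³ + y³)`"**
(`3 = 0`, `abc ≠ 0`): `F ∘ S = (ab)⁻¹·XYZ + (d/c³)·(X³ + Y³ + Z³)`. [cite: ArtebaniDolgachev2009, §2,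
Remark 2.1] -/
theorem web_bind₁_of_three_eq_zero (h3 : (3 : K) = 0) {a b c : K} (ha : a ≠ 0) (hb : b ≠ 0)
    (hc : c ≠ 0) (d : K) :
    bind₁ (𝐒[a, b, c] : Matrix (Fin 3) (Fin 3) K).toMvPolynomial 𝐅[a, b, c, d] =
      C (a⁻¹ * b⁻¹) * (X 0 * X 1 * X 2) + C (d * c⁻¹ ^ 3) * (X 0 ^ 3 + X 1 ^ 3 + X 2 ^ 3) := by
  rw [web_bind₁_scale_translate ha hb hc d]
  have h := hesseE_of_three_eq_zero h3 (0 : K)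
  simp only [map_zero, zero_mul, add_zero] at h
  rw [← h]

/-- **The web cubic is a nonsingular member of the Hesse pencil, up to projective equivalence**
(`3 = 0`, `abcd ≠ 0`): `F ∘ S = (d/c³) · E_t` with `t = c³/(abd)` (`≠ 0`).
[cite: ArtebaniDolgachev2009, §2, Remark 2.1] -/
theorem web_bind₁_eq_smul_hesseE (h3 : (3 : K) = 0) {a b c d : K} (ha : a ≠ 0) (hb : b ≠ 0)
    (hc : c ≠ 0) (hd : d ≠ 0) :
    bind₁ (𝐒[a, b, c] : Matrix (Fin 3) (Fin 3) K).toMvPolynomial 𝐅[a, b, c, d] =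
      (d * c⁻¹ ^ 3) • (𝐄[c ^ 3 * (a * b * d)⁻¹] : MvPolynomial (Fin 3) K) ∧
      c ^ 3 * (a * b * d)⁻¹ ≠ 0 := by
  refine ⟨?_, mul_ne_zero (pow_ne_zero 3 hc) (inv_ne_zero (mul_ne_zero (mul_ne_zero ha hb) hd))⟩
  have e : d * c⁻¹ ^ 3 * (c ^ 3 * (a * b * d)⁻¹) = a⁻¹ * b⁻¹ := by field_simp
  rw [web_bind₁_of_three_eq_zero h3 ha hb hc d, smul_eq_C_mul, ← e]
  simp only [map_mul, map_pow]
  ring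

/-- `det S = (abc)⁻¹`, non-zero: `S` is a projectivity. [cite: ArtebaniDolgachev2009, §2, Remark 2.1] -/
theorem web_matrix_det {a b c : K} (ha : a ≠ 0) (hb : b ≠ 0) (hc : c ≠ 0) :
    (𝐒[a, b, c] : Matrix (Fin 3) (Fin 3) K).det = a⁻¹ * b⁻¹ * c⁻¹ ∧
      (𝐒[a, b, c] : Matrix (Fin 3) (Fin 3) K).det ≠ 0 := by
  have h : (𝐒[a, b, c] : Matrix (Fin 3) (Fin 3) K).det = a⁻¹ * b⁻¹ * c⁻¹ := by
    rw [Matrix.det_fin_three]; simp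
  exact ⟨h, by rw [h]; exact mul_ne_zero (mul_ne_zero (inv_ne_zero ha) (inv_ne_zero hb)) (inv_ne_zero hc)⟩

/-- The degenerate case `d = 0`: `F = xy·(ax + by + cz)` is the union of three lines (reducible, hence
singular), so a nonsingular web cubic has `d ≠ 0`. [cite: ArtebaniDolgachev2009, §2, proof of Lemma 1
("otherwise the curve would be singular")] -/
theorem web_reducible_of_d_eq_zero (a b c : K) :
    (𝐅[a, b, c, (0 : K)] : MvPolynomial (Fin 3) K) = X 0 * X 1 * (C a * X 0 + C b * X 1 + C c * X 2) := by
  rw [map_zero, zero_mul, add_zero]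

end CharThreeWebForm

end Literature.AlgebraicGeometry.PlaneCurves
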